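import Summits.KontsevichZagierPeriods.KontsevichZagierPeriods.Theorems.SoloInformedNashImage
import Summits.KontsevichZagierPeriods.KontsevichZagierPeriods.Theorems.SoloInformedToricJacobian
import Literature.AlgebraicGeometry.Resolution.CubeMonomialChartsPrincipalization
import HarnessLib

/-!
# The toric sector of the cube crux

Solo programme `solo-KontsevichZagierPeriods-informed`, session s103 (THEOREM T of the census
`work/s103/resolution_census_s103.md`).

The cube crux `SoloInformedAyoubCubeResolutionCube` (Ayoub 2014, Prop. 2.11 restricted to cube
domains) asks that every `IntegralRep` on `[0,1]ⁿ` be rewritten, inside the KZ calculus, as a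
`ℤ`-combination of integrals over cubes of real parts of `ℚ̄ ∩ ℝ`-germs holomorphic near the closed
cube.  This file settles its **toric sector**:

* `soloInformed_presentable_of_posRational` — if `r.domain = [0,1]ⁿ` and on the open cube
  `r.integrand = x^p / Q(x)` with `p ∈ ℕⁿ` and `Q ∈ ℚ[x₁,…,xₙ]` non-zero with all its (non-zero)
  coefficients positive, then `of r ∈ soloInformedPresentable`;
* `soloInformed_cubeResolution_posRational` — the same in the `Fin`-indexed output format of the
  crux.

No regularity of `x^p/Q` at the boundary is assumed beyond integrability (e.g. `1/(x+y)`).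

## Proof
By `MonomialCubeChart.exists_cube_charts_pairwise_comparable` (iterated stellar subdivision of the
positive orthant fan — Kempf–Knudsen–Mumford–Saint-Donat 1973, ch. I §2; Fulton 1993, §2.6; Cox 2000,
§5) there are finitely many unimodular monomial charts `μ_c(v)ᵢ = ∏ⱼ vⱼ^{A_c i j}` of the open cube,
with pairwise disjoint images covering it up to a null set, on each of which the pulled-back exponent
vectors `{A_cᵀ a : a ∈ supp Q}` form a chain.  On a chart with least exponent `m = A_cᵀ a₀` one has
`Q(μ_c v) = v^m · Q_c(v)` with `Q_c` a positive-coefficient polynomial with non-zero constant term,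
hence `Q_c > 0` on the closed cube (`soloInformed_aeval_monomialMap_eq`, `soloInformed_chartQuot_pos`),
and by the Jacobian formula (`soloInformed_abs_det_monoD`)
`(x^p/Q)(μ_c v) · |det Dμ_c(v)| = |det A_c| · v^U / (v^{m+1} · Q_c(v))`, `U = A_cᵀ p + A_cᵀ 1`.
Integrability of `r` on the chart image and the change-of-variables formula make `v^U / v^{m+1}`
integrable on `(0,1)ⁿ`, so `m + 1 ≤ U` by the integrability test
(`soloInformed_le_of_integrableOn_monomialRatio`); thus the pulled-back form is
`Re` of the rational germ `|det A_c| v^{U−m−1} / Q_c(v)`, holomorphic near the closed cube, and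
`soloInformed_presentable_of_nashImage` presents the chart piece.  The pieces are glued to `of r` by
domain additivity up to null sets (`KZ.of_sub_sum_of_mem_relations`).

References: J. Ayoub, Ann. of Math. 181 (2015), §2.2; M. Kontsevich, D. Zagier, *Periods* (2001),
§1.2; W. Fulton, *Introduction to Toric Varieties* (1993), §2.6.
-/

noncomputable section

open scoped BigOperators
open MeasureTheory Set
open Literature.NumberTheory.Transcendental Literature.NumberTheory.Transcendental.KZ
open Literature.ModelTheory.ExponentialFields (IsSemialgebraic)
open Literature.AlgebraicGeometry.Resolution

namespace Summit.KontsevichZagierPeriods.KontsevichZagierPeriods.Theorems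

variable {n : ℕ}

/-! ### A least element of a finite chain of exponent vectors -/

/-- A non-empty finite family of vectors of `ℕⁿ`, pairwise comparable componentwise, has a least
member. [this work] -/
theorem soloInformed_exists_least_of_pairwise_comparable {ι : Type*} (S : Finset ι)
    (hS : S.Nonempty) (e : ι → Fin n → ℕ)
    (hcomp : ∀ a ∈ S, ∀ b ∈ S, (∀ j, e a j ≤ e b j) ∨ (∀ j, e b j ≤ e a j)) :
    ∃ a₀ ∈ S, ∀ a ∈ S, ∀ j, e a₀ j ≤ e a j := by
  obtain ⟨a₀, ha₀, hmin⟩ := Finset.exists_min_image S (fun a => ∑ j, e a j) hS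
  refine ⟨a₀, ha₀, fun a ha => ?_⟩
  rcases hcomp a₀ ha₀ a ha with h | h
  · exact h
  · have hle : ∑ j, e a j ≤ ∑ j, e a₀ j := Finset.sum_le_sum fun j _ => h j
    have heq : ∑ j, e a j = ∑ j, e a₀ j := le_antisymm hle (hmin a ha)
    have h' := (Finset.sum_eq_sum_iff_of_le fun j _ => h j).1 heq
    exact fun j => (h' j (Finset.mem_univ j)).ge

/-! ### Evaluating `ℚ`-polynomials -/

/-- `Q(y) = ∑_{a ∈ supp Q} coeff_a(Q) · yᵃ`. [this work] -/
theorem soloInformed_aeval_eq_sum_support {R : Type*} [CommRing R] [Algebra ℚ R]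
    (Q : MvPolynomial (Fin n) ℚ) (y : Fin n → R) :
    MvPolynomial.aeval y Q =
      ∑ a ∈ Q.support, algebraMap ℚ R (MvPolynomial.coeff a Q) * ∏ i, y i ^ a i := by
  conv_lhs => rw [Q.as_sum]
  rw [map_sum]
  exact Finset.sum_congr rfl fun a _ => by
    rw [MvPolynomial.aeval_monomial, Finsupp.prod_fintype _ _ fun i => pow_zero _]

/-! ### The chart quotient polynomial -/

/-- The **chart quotient** `Q_A := ∑_{a ∈ supp Q} coeff_a(Q) · X^{Aᵀ a − m}`: for `m` the least
pulled-back exponent, `Q(μ_A v) = v^m · Q_A(v)`. [this work] -/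
def soloInformedChartQuot (A : Matrix (Fin n) (Fin n) ℕ) (Q : MvPolynomial (Fin n) ℚ)
    (m : Fin n → ℕ) : MvPolynomial (Fin n) ℚ :=
  ∑ a ∈ Q.support, MvPolynomial.monomial
    (Finsupp.equivFunOnFinite.symm fun j => (∑ i, A i j * a i) - m j) (MvPolynomial.coeff a Q)

/-- Evaluation of the chart quotient. [this work] -/
theorem soloInformed_aeval_chartQuot {R : Type*} [CommRing R] [Algebra ℚ R]
    (A : Matrix (Fin n) (Fin n) ℕ) (Q : MvPolynomial (Fin n) ℚ) (m : Fin n → ℕ) (x : Fin n → R) :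
    MvPolynomial.aeval x (soloInformedChartQuot A Q m) =
      ∑ a ∈ Q.support, algebraMap ℚ R (MvPolynomial.coeff a Q) *
        ∏ j, x j ^ ((∑ i, A i j * a i) - m j) := by
  unfold soloInformedChartQuot
  rw [map_sum]
  refine Finset.sum_congr rfl fun a _ => ?_
  rw [MvPolynomial.aeval_monomial, Finsupp.prod_fintype _ _ fun i => pow_zero _]
  simp only [Finsupp.coe_equivFunOnFinite_symm]

/-- **Factorisation on a chart**: if `m ≤ Aᵀ a` for every `a ∈ supp Q` then
`Q(μ_A v) = v^m · Q_A(v)`. [this work] -/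
theorem soloInformed_aeval_monomialMap_eq (A : Matrix (Fin n) (Fin n) ℕ)
    (Q : MvPolynomial (Fin n) ℚ) (m : Fin n → ℕ)
    (hm : ∀ a ∈ Q.support, ∀ j, m j ≤ ∑ i, A i j * a i) (v : Fin n → ℝ) :
    MvPolynomial.aeval (fun i => ∏ j, v j ^ A i j) Q =
      (∏ j, v j ^ m j) * MvPolynomial.aeval v (soloInformedChartQuot A Q m) := by
  rw [soloInformed_aeval_eq_sum_support, soloInformed_aeval_chartQuot, Finset.mul_sum]
  refine Finset.sum_congr rfl fun a ha => ?_
  have h1 : (∏ i, (∏ j, v j ^ A i j) ^ a i) = ∏ j, v j ^ (∑ i, A i j * a i) :=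
    prod_pow_monomialMap A (fun i => a i) (fun i => rfl)
  have h2 : (∏ j, v j ^ (∑ i, A i j * a i)) =
      (∏ j, v j ^ m j) * ∏ j, v j ^ ((∑ i, A i j * a i) - m j) :=
    prod_pow_eq_mul_of_le v (p := m) (q := fun j => ∑ i, A i j * a i) fun j => hm a ha j
  rw [h1, h2]
  ring

/-- **Positivity of the chart quotient**: if all coefficients of `Q` are positive and `m = Aᵀ a₀`
for some `a₀ ∈ supp Q`, then `Q_A > 0` on the closed positive orthant (its `a₀`-term is the
positive constant `coeff_{a₀}(Q)`). [this work] -/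
theorem soloInformed_chartQuot_pos (A : Matrix (Fin n) (Fin n) ℕ) (Q : MvPolynomial (Fin n) ℚ)
    (hQ : ∀ a ∈ Q.support, 0 < MvPolynomial.coeff a Q) {m : Fin n → ℕ} {a₀ : Fin n →₀ ℕ}
    (ha₀ : a₀ ∈ Q.support) (hm₀ : ∀ j, m j = ∑ i, A i j * a₀ i) {x : Fin n → ℝ}
    (hx : ∀ j, 0 ≤ x j) : 0 < MvPolynomial.aeval x (soloInformedChartQuot A Q m) := by
  rw [soloInformed_aeval_chartQuot]
  simp only [eq_ratCast]
  have hterm : ∀ a ∈ Q.support, 0 ≤ ((MvPolynomial.coeff a Q : ℚ) : ℝ) *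
      ∏ j, x j ^ ((∑ i, A i j * a i) - m j) := fun a ha =>
    mul_nonneg (by exact_mod_cast (hQ a ha).le) (Finset.prod_nonneg fun j _ => pow_nonneg (hx j) _)
  refine lt_of_lt_of_le ?_ (Finset.single_le_sum hterm ha₀)
  have h0 : ∀ j, (∑ i, A i j * a₀ i) - m j = 0 := fun j => by rw [hm₀ j, Nat.sub_self]
  simp only [h0, pow_zero, Finset.prod_const_one, mul_one]
  exact_mod_cast hQ a₀ ha₀

/-- **Bound for the chart quotient** on the closed cube: `|Q_A(x)| ≤ ∑_a coeff_a(Q)`. [this work] -/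
theorem soloInformed_abs_chartQuot_le (A : Matrix (Fin n) (Fin n) ℕ) (Q : MvPolynomial (Fin n) ℚ)
    (m : Fin n → ℕ) (hQ : ∀ a ∈ Q.support, 0 < MvPolynomial.coeff a Q) {x : Fin n → ℝ}
    (hx : ∀ j, 0 ≤ x j ∧ x j ≤ 1) :
    |MvPolynomial.aeval x (soloInformedChartQuot A Q m)| ≤
      ∑ a ∈ Q.support, ((MvPolynomial.coeff a Q : ℚ) : ℝ) := by
  rw [soloInformed_aeval_chartQuot]
  simp only [eq_ratCast]
  have hterm : ∀ a ∈ Q.support, 0 ≤ ((MvPolynomial.coeff a Q : ℚ) : ℝ) *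
      ∏ j, x j ^ ((∑ i, A i j * a i) - m j) := fun a ha =>
    mul_nonneg (by exact_mod_cast (hQ a ha).le)
      (Finset.prod_nonneg fun j _ => pow_nonneg (hx j).1 _)
  rw [abs_of_nonneg (Finset.sum_nonneg hterm)]
  refine Finset.sum_le_sum fun a ha => ?_
  calc ((MvPolynomial.coeff a Q : ℚ) : ℝ) * ∏ j, x j ^ ((∑ i, A i j * a i) - m j)
      ≤ ((MvPolynomial.coeff a Q : ℚ) : ℝ) * 1 :=
        mul_le_mul_of_nonneg_left (Finset.prod_le_one (fun j _ => pow_nonneg (hx j).1 _)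
          fun j _ => pow_le_one₀ (hx j).1 (hx j).2) (by exact_mod_cast (hQ a ha).le)
    _ = _ := mul_one _

/-- `det A`, computed in `ℚ` and cast to `ℝ`, is `det A` computed in `ℝ`. [this work] -/
theorem soloInformed_ratCast_det_map (A : Matrix (Fin n) (Fin n) ℕ) :
    (((A.map (fun t : ℕ => (t : ℚ))).det : ℚ) : ℝ) = (A.map (fun t : ℕ => (t : ℝ))).det := by
  rw [show (((A.map (fun t : ℕ => (t : ℚ))).det : ℚ) : ℝ) =
      Rat.castHom ℝ (A.map (fun t : ℕ => (t : ℚ))).det from rfl,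
    RingHom.map_det, RingHom.mapMatrix_apply, Matrix.map_map]
  congr 1

/-! ### One toric chart -/

/-- **Presentation of one toric chart piece.**  Let `A` be an exponent matrix with `det A ≠ 0`,
`Q` a positive-coefficient polynomial whose pulled-back exponents `Aᵀ a` (`a ∈ supp Q`) have a
least element `m = Aᵀ a₀`, and `R` an `IntegralRep` on the chart image `μ_A((0,1)ⁿ)` whose
integrand there is `y^p / Q(y)`.  Then `of R` is presentable: the pulled-back form is `Re` of the
rational germ `|det A| · v^{Aᵀp + Aᵀ1 − m − 1} / Q_A(v)`, the exponent being non-negative by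
integrability. [this work] -/
theorem soloInformed_presentable_toricChart (A : Matrix (Fin n) (Fin n) ℕ)
    (hA : (A.map (fun t : ℕ => (t : ℝ))).det ≠ 0) (p : Fin n → ℕ) (Q : MvPolynomial (Fin n) ℚ)
    (hQ : ∀ a ∈ Q.support, 0 < MvPolynomial.coeff a Q) {a₀ : Fin n →₀ ℕ} (ha₀ : a₀ ∈ Q.support)
    (m : Fin n → ℕ) (hm₀ : ∀ j, m j = ∑ i, A i j * a₀ i)
    (hmin : ∀ a ∈ Q.support, ∀ j, m j ≤ ∑ i, A i j * a i) (R : IntegralRep n)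
    (hdom : R.domain =
      (fun (v : Fin n → ℝ) (i : Fin n) => ∏ j, v j ^ A i j) '' soloInformedOpenCube n)
    (hRi : ∀ v ∈ soloInformedOpenCube n, R.integrand (fun i => ∏ j, v j ^ A i j) =
      (∏ i, (∏ j, v j ^ A i j) ^ p i) / MvPolynomial.aeval (fun i => ∏ j, v j ^ A i j) Q) :
    of R ∈ soloInformedPresentable := by
  classical
  have hO := soloInformedOpenCube_eq_pi n
  have hQc_pos : ∀ x : Fin n → ℝ, (∀ j, 0 ≤ x j) →
      0 < MvPolynomial.aeval x (soloInformedChartQuot A Q m) :=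
    fun x hx => soloInformed_chartQuot_pos A Q hQ ha₀ hm₀ hx
  -- (★) the pulled-back integrand times the Jacobian
  have hkey : ∀ v ∈ soloInformedOpenCube n,
      R.integrand (fun i => ∏ j, v j ^ A i j) * |(soloInformedMonoD A v).det| =
        |(A.map (fun t : ℕ => (t : ℝ))).det| *
          ((∏ j, v j ^ ((∑ i, A i j * p i) + ∑ i, A i j)) /
            ((∏ j, v j ^ (m j + 1)) * MvPolynomial.aeval v (soloInformedChartQuot A Q m))) := by
    intro v hv
    have hv0 : ∀ j, 0 < v j := fun j => (hv j).1
    have hnum : (∏ i, (∏ j, v j ^ A i j) ^ p i) = ∏ j, v j ^ (∑ i, A i j * p i) :=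
      prod_pow_monomialMap A p (fun i => rfl)
    rw [hRi v hv, soloInformed_abs_det_monoD A hv0, hnum,
      soloInformed_aeval_monomialMap_eq A Q m hmin v]
    have hU : (∏ j, v j ^ ((∑ i, A i j * p i) + ∑ i, A i j)) =
        (∏ j, v j ^ (∑ i, A i j * p i)) * ∏ j, v j ^ (∑ i, A i j) := by
      rw [← Finset.prod_mul_distrib]
      exact Finset.prod_congr rfl fun j _ => pow_add _ _ _
    have hW : (∏ j, v j ^ (m j + 1)) = (∏ j, v j ^ m j) * ∏ j, v j := by
      rw [← Finset.prod_mul_distrib]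
      exact Finset.prod_congr rfl fun j _ => pow_succ _ _
    rw [hU, hW]
    have h1 : (∏ j, v j) ≠ 0 := Finset.prod_ne_zero_iff.2 fun j _ => (hv0 j).ne'
    have h2 : (∏ j, v j ^ m j) ≠ 0 :=
      Finset.prod_ne_zero_iff.2 fun j _ => pow_ne_zero _ (hv0 j).ne'
    have h3 : MvPolynomial.aeval v (soloInformedChartQuot A Q m) ≠ 0 :=
      (hQc_pos v fun j => (hv0 j).le).ne'
    field_simp
  -- measurability, derivative and injectivity on the open cube
  have hmeasO : MeasurableSet (soloInformedOpenCube n) := by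
    rw [hO]; exact MeasurableSet.univ_pi fun _ => measurableSet_Ioo
  have hderiv : ∀ x ∈ soloInformedOpenCube n, HasFDerivWithinAt
      (fun (v : Fin n → ℝ) (i : Fin n) => ∏ j, v j ^ A i j) (soloInformedMonoD A x)
      (soloInformedOpenCube n) x :=
    fun x _ => soloInformed_hasFDerivWithinAt_monomialMap A _ x
  have hinj : InjOn (fun (v : Fin n → ℝ) (i : Fin n) => ∏ j, v j ^ A i j)
      (soloInformedOpenCube n) := by
    rw [hO]; exact injOn_monomialMap_pi_Ioo hA
  -- integrability of the pulled-back form (change of variables) ...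
  have hint1 : IntegrableOn (fun v => |(soloInformedMonoD A v).det| •
      R.integrand (fun i => ∏ j, v j ^ A i j)) (soloInformedOpenCube n) := by
    have h := R.integrableOn
    rw [hdom, integrableOn_image_iff_integrableOn_abs_det_fderiv_smul volume hmeasO hderiv hinj]
      at h
    exact h
  -- ... hence of the monomial ratio `v^U / v^{m+1}` (the factor `Q_A/|det A|` is bounded)
  have hratio : IntegrableOn (fun v : Fin n → ℝ =>
      (∏ j, v j ^ ((∑ i, A i j * p i) + ∑ i, A i j)) / ∏ j, v j ^ (m j + 1))
      (Set.pi univ fun _ : Fin n => Ioo (0 : ℝ) 1) := by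
    rw [← hO]
    -- continuity of `v ↦ Q_A(v)` (cf. `soloInformed_continuous_aeval` in `SoloInformedSubgraph`)
    have hcont : Continuous fun v : Fin n → ℝ =>
        (MvPolynomial.aeval v (soloInformedChartQuot A Q m) : ℝ) := by
      have h : (fun v : Fin n → ℝ => (MvPolynomial.aeval v (soloInformedChartQuot A Q m) : ℝ)) =
          fun v => MvPolynomial.eval v
            (MvPolynomial.map (algebraMap ℚ ℝ) (soloInformedChartQuot A Q m)) :=
        funext fun v => by rw [MvPolynomial.eval_map, MvPolynomial.aeval_def]
      rw [h]
      exact MvPolynomial.continuous_eval _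
    have hb : IntegrableOn (fun v => (MvPolynomial.aeval v (soloInformedChartQuot A Q m) /
        |(A.map (fun t : ℕ => (t : ℝ))).det|) * (|(soloInformedMonoD A v).det| •
        R.integrand (fun i => ∏ j, v j ^ A i j))) (soloInformedOpenCube n) := by
      refine Integrable.bdd_mul hint1 ((hcont.div_const _).aestronglyMeasurable)
        (c := (∑ a ∈ Q.support, ((MvPolynomial.coeff a Q : ℚ) : ℝ)) /
          |(A.map (fun t : ℕ => (t : ℝ))).det|)
        (ae_restrict_of_forall_mem hmeasO fun v hv => ?_)
      rw [Real.norm_eq_abs, abs_div, abs_abs]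
      exact div_le_div_of_nonneg_right
        (soloInformed_abs_chartQuot_le A Q m hQ fun j => ⟨(hv j).1.le, (hv j).2.le⟩)
        (abs_nonneg _)
    refine hb.congr_fun (fun v hv => ?_) hmeasO
    have hv0 : ∀ j, 0 < v j := fun j => (hv j).1
    dsimp only
    rw [smul_eq_mul, mul_comm |(soloInformedMonoD A v).det|, hkey v hv]
    have h1 : (∏ j, v j ^ (m j + 1)) ≠ 0 :=
      Finset.prod_ne_zero_iff.2 fun j _ => pow_ne_zero _ (hv0 j).ne'
    have h3 : MvPolynomial.aeval v (soloInformedChartQuot A Q m) ≠ 0 :=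
      (hQc_pos v fun j => (hv0 j).le).ne'
    have h4 : |(A.map (fun t : ℕ => (t : ℝ))).det| ≠ 0 := abs_ne_zero.2 hA
    field_simp
  -- the exponent `U − m − 1` is non-negative
  have hle : ∀ j, m j + 1 ≤ (∑ i, A i j * p i) + ∑ i, A i j :=
    soloInformed_le_of_integrableOn_monomialRatio _ _ hratio
  obtain ⟨e, he⟩ : ∃ e : Fin n → ℕ, ∀ j, (∑ i, A i j * p i) + ∑ i, A i j = (m j + 1) + e j :=
    ⟨fun j => ((∑ i, A i j * p i) + ∑ i, A i j) - (m j + 1),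
      fun j => (Nat.add_sub_cancel' (hle j)).symm⟩
  -- the germ `|det A| · X^e / Q_A`
  have hQc : ∀ x ∈ soloInformedCube n,
      MvPolynomial.aeval (soloInformedToC n x) (soloInformedChartQuot A Q m) ≠ 0 := by
    intro x hx
    have hx' : ∀ j, 0 ≤ x j := fun j => (soloInformed_mem_cube_iff.1 hx j).1
    have h := soloInformed_ofReal_aeval x (soloInformedChartQuot A Q m)
    simp only [← soloInformedToC_apply] at h
    rw [← h, Complex.ofReal_ne_zero]
    exact (hQc_pos x hx').ne'
  refine soloInformed_presentable_of_nashImage R (fun (v : Fin n → ℝ) (i : Fin n) => ∏ j, v j ^ A i j)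
    (soloInformedMonoD A)
    (soloInformedRationalGerm (MvPolynomial.C |(A.map (fun t : ℕ => (t : ℚ))).det| *
      ∏ j, MvPolynomial.X j ^ e j) (soloInformedChartQuot A Q m) hQc)
    (isSemialgebraicMapOn_monomialMap A (isSemialgebraic_soloInformedOpenCube n))
    hderiv hinj hdom fun v hv => ?_
  -- the integrand identity on the open cube
  have hv0 : ∀ j, 0 < v j := fun j => (hv j).1
  show (MvPolynomial.aeval (soloInformedToC n v)
      (MvPolynomial.C |(A.map (fun t : ℕ => (t : ℚ))).det| * ∏ j, MvPolynomial.X j ^ e j) /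
    MvPolynomial.aeval (soloInformedToC n v) (soloInformedChartQuot A Q m)).re = _
  have hp := soloInformed_ofReal_aeval v
    (MvPolynomial.C |(A.map (fun t : ℕ => (t : ℚ))).det| * ∏ j, MvPolynomial.X j ^ e j)
  have hq := soloInformed_ofReal_aeval v (soloInformedChartQuot A Q m)
  simp only [← soloInformedToC_apply] at hp hq
  rw [← hp, ← hq, ← Complex.ofReal_div, Complex.ofReal_re, hkey v hv]
  simp only [map_mul, MvPolynomial.aeval_C, map_prod, map_pow, MvPolynomial.aeval_X, eq_ratCast,
    Rat.cast_abs, soloInformed_ratCast_det_map]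
  have hU : (∏ j, v j ^ ((∑ i, A i j * p i) + ∑ i, A i j)) =
      (∏ j, v j ^ (m j + 1)) * ∏ j, v j ^ e j := by
    rw [← Finset.prod_mul_distrib]
    exact Finset.prod_congr rfl fun j _ => by rw [he j, pow_add]
  rw [hU]
  have h1 : (∏ j, v j ^ (m j + 1)) ≠ 0 :=
    Finset.prod_ne_zero_iff.2 fun j _ => pow_ne_zero _ (hv0 j).ne'
  have h3 : MvPolynomial.aeval v (soloInformedChartQuot A Q m) ≠ 0 :=
    (hQc_pos v fun j => (hv0 j).le).ne'
  field_simp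

/-! ### The theorem -/

/-- **THEOREM T — the toric sector of the cube crux.**  Let `r` be an `IntegralRep` on the closed
cube `[0,1]ⁿ` whose integrand agrees on the open cube with `x^p / Q(x)`, where `p ∈ ℕⁿ` and
`Q ∈ ℚ[x₁, …, xₙ]` is non-zero with all its coefficients positive.  Then `of r` is presentable:
`k • of r − ∑ⱼ cⱼ • of ρⱼ ∈ KZ.relations` for some `k ≠ 0` and finitely many cube integrals `ρⱼ`
of real parts of germs holomorphic near the closed cube (in fact `k = 1`, `cⱼ = 1`).
[this work; Ayoub 2014 §2.2 (format); KKMS 1973 / Fulton 1993 §2.6 (toric charts)] -/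
theorem soloInformed_presentable_of_posRational (p : Fin n → ℕ) (Q : MvPolynomial (Fin n) ℚ)
    (hQ0 : Q ≠ 0) (hQ : ∀ a ∈ Q.support, 0 < MvPolynomial.coeff a Q) (r : IntegralRep n)
    (hr : r.domain = soloInformedCube n)
    (hri : EqOn r.integrand (fun x => (∏ j, x j ^ p j) / MvPolynomial.aeval x Q)
      (soloInformedOpenCube n)) :
    of r ∈ soloInformedPresentable := by
  classical
  have hO := soloInformedOpenCube_eq_pi n
  obtain ⟨M, A, hdet, hdisj, hcov, hcmp⟩ :=
    MonomialCubeChart.exists_cube_charts_pairwise_comparable n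
      (Q.support.image fun a : Fin n →₀ ℕ => (a : Fin n → ℕ))
  rw [← hO] at hdisj hcov
  have hne : Q.support.Nonempty :=
    Finset.nonempty_iff_ne_empty.2 fun h => hQ0 (MvPolynomial.support_eq_empty.1 h)
  have hmaps : ∀ c, MapsTo (fun (v : Fin n → ℝ) (i : Fin n) => ∏ j, v j ^ A c i j)
      (soloInformedOpenCube n) (soloInformedOpenCube n) := fun c => by
    rw [hO]; exact monomialMap_mapsTo_pi_Ioo (hdet c)
  have himg : ∀ c, IsSemialgebraic ℚ
      ((fun (v : Fin n → ℝ) (i : Fin n) => ∏ j, v j ^ A c i j) '' soloInformedOpenCube n) :=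
    fun c => IsSemialgebraicMapOn.isSemialgebraic_image_holds
      (isSemialgebraicMapOn_monomialMap (A c) (isSemialgebraic_soloInformedOpenCube n))
      Subset.rfl (isSemialgebraic_soloInformedOpenCube n)
  have hsub : ∀ c, (fun (v : Fin n → ℝ) (i : Fin n) => ∏ j, v j ^ A c i j) ''
      soloInformedOpenCube n ⊆ r.domain := fun c => by
    rw [hr]; exact (hmaps c).image_subset.trans (soloInformedOpenCube_subset_cube n)
  -- the chart pieces
  set R : Fin M → IntegralRep n := fun c =>
    r.restrict ((fun (v : Fin n → ℝ) (i : Fin n) => ∏ j, v j ^ A c i j) '' soloInformedOpenCube n)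
      (himg c) (hsub c) with hR
  have hRdom : ∀ c, (R c).domain =
      (fun (v : Fin n → ℝ) (i : Fin n) => ∏ j, v j ^ A c i j) '' soloInformedOpenCube n :=
    fun c => rfl
  have hpiece : ∀ c, of (R c) ∈ soloInformedPresentable := by
    intro c
    obtain ⟨a₀, ha₀, hmin⟩ := soloInformed_exists_least_of_pairwise_comparable Q.support hne
      (fun (a : Fin n →₀ ℕ) (j : Fin n) => ∑ i, A c i j * a i) fun a ha b hb =>
        hcmp c _ (Finset.mem_image_of_mem _ ha) _ (Finset.mem_image_of_mem _ hb)
    exact soloInformed_presentable_toricChart (A c) (hdet c) p Q hQ ha₀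
      (fun j => ∑ i, A c i j * a₀ i) (fun j => rfl) hmin (R c) (hRdom c)
      fun v hv => hri (hmaps c hv)
  -- gluing by domain additivity up to null sets
  have hU : (⋃ c ∈ (Finset.univ : Finset (Fin M)), (R c).domain) =
      ⋃ c, (fun (v : Fin n → ℝ) (i : Fin n) => ∏ j, v j ^ A c i j) '' soloInformedOpenCube n := by
    simp only [Finset.mem_univ, Set.iUnion_true, hRdom]
  have hglue : of r - ∑ c, of (R c) ∈ relations := by
    refine of_sub_sum_of_mem_relations Finset.univ r R (fun c _ => ?_) (fun c _ _ _ => rfl) ?_ ?_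
    · rw [hRdom, Set.sdiff_eq_empty.2 (hsub c)]; exact measure_empty
    · rw [hU, hr]
      refine measure_mono_null (fun x hx => ?_)
        (measure_union_null (soloInformed_volume_cube_diff_openCube n) hcov)
      by_cases hxo : x ∈ soloInformedOpenCube n
      · exact Or.inr ⟨hxo, hx.2⟩
      · exact Or.inl ⟨hx.1, hxo⟩
    · intro c _ c' _ hcc'
      rw [hRdom, hRdom, (hdisj hcc').inter_eq]; exact measure_empty
  exact soloInformed_presentable_of_sub_mem hglue
    (soloInformed_presentable_sum _ _ fun c _ => hpiece c)

/-- **THEOREM T in the output format of the cube crux** `SoloInformedAyoubCubeResolutionCube`: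
positive-coefficient rational integrands on `[0,1]ⁿ` admit an Ayoub cube resolution inside the
KZ calculus. [this work] -/
theorem soloInformed_cubeResolution_posRational (p : Fin n → ℕ) (Q : MvPolynomial (Fin n) ℚ)
    (hQ0 : Q ≠ 0) (hQ : ∀ a ∈ Q.support, 0 < MvPolynomial.coeff a Q) (r : IntegralRep n)
    (hr : r.domain = soloInformedCube n)
    (hri : EqOn r.integrand (fun x => (∏ j, x j ^ p j) / MvPolynomial.aeval x Q)
      (soloInformedOpenCube n)) :
    ∃ (k : ℕ) (_ : k ≠ 0) (m : ℕ) (d : Fin m → ℕ) (G : ∀ j, SoloInformedCubeGerm (d j))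
      (c : Fin m → ℤ) (ρ : ∀ j, IntegralRep (d j)),
      (∀ j, (ρ j).domain = soloInformedCube (d j)) ∧
      (∀ j, EqOn (ρ j).integrand (fun x => ((G j).g (soloInformedToC (d j) x)).re)
        (soloInformedCube (d j))) ∧
      k • of r - ∑ j, c j • of (ρ j) ∈ relations :=
  soloInformed_exists_fin_of_presentable (soloInformed_presentable_of_posRational p Q hQ0 hQ r hr hri)

end Summit.KontsevichZagierPeriods.KontsevichZagierPeriods.Theorems
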